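import Summits.BirchSwinnertonDyer.Rank1Residual.Additive.CyclotomicThreeMultiplicativeReduction
import Literature.NumberTheory.EllipticCurves.QuadraticTwistKroneckerLFunctionProofs
import Literature.NumberTheory.EllipticCurves.QuadraticTwistLFunctionProofs
import Literature.NumberTheory.EllipticCurves.KodairaNeronLeFourProofs
import Literature.NumberTheory.EllipticCurves.SzpiroLocalDataProofs
import Literature.NumberTheory.EllipticCurves.TamagawaNeZeroProofs
import Literature.NumberTheory.DiophantineGeometry.LocalReductionHasMultiplicativeReductionAtProofs
import Literature.NumberTheory.DiophantineGeometry.MinimalDiscriminantNormProofs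
import HarnessLib

/-!
# The RAMIFIED quadratic twist of a multiplicative place (`ℓ ∥ d`, `ℓ` odd): additive,
# `ord Δ_min ↦ n + 6`, twist equation minimal, `c ≤ 4` (row T-MIL-ODD, FILE A-2b; seat n1011-p01 GEN 5)

HONEST FRAMING (cell `b2b-bsdres`, run/shared/lean/b2b/bsd-rank1-residual/, verbatim in every
file): the goal of the cell is to DELETE the COMBINATION-SHAPED residual classes of the
Birch–Swinnerton-Dyer formula for ALL analytic-rank `≤ 1` elliptic curves over `ℚ` — "full BSD
formula for every rank `≤ 1` curve in class `C`" assembled STRICTLY from published theorems — so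
that the rank-`≤ 1` remainder becomes exactly the CONSTRUCTION-SHAPED classes, which are TYPED
(missing-input `Prop`s), NOT attempted. This is not "finishing BSD". Sub-classes X3♯(M) / X4(M)
(additive, potentially multiplicative prime; base-change-and-descend): a RESEARCH ROUTE; they stay
CONSTRUCTION-SHAPED; nothing is booked by this file; no mark / label moved. THEOREMS ONLY: no
definition, no named fact, no `sorry`.

## What and why (row T-MIL-ODD, `cells/n1011/skel/T-MIL-ODD.md`, §1 (M), twist side, `ℓ ∣ d_K`)

In the odd part of Milne's quadratic BSD-quotient identity (`hWR` of `AdditivePotMult/Descent`,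
A65/A73; `hodd` of `bsdRHS_baseChange_quadratic_of_padicValRat`) the twist model enters through
`∏_ℓ c_ℓ(Wd)` AND through the scaling `u_d` of `Cd • W^{(d_K)} = Wd` (`v_p(|u_d|)`). At a
MULTIPLICATIVE place `v` of `V/ℚ` (globally minimal) over an odd prime `ℓ` dividing `d` exactly
once:

* `hasAdditiveReductionAt_quadraticTwist_of_dvd_of_mult` — the explicit equation `V^{(d)}` is
  `v`-integral and MINIMAL (`ord_v c₄ = 2 < 4`), `V^{(d)}` is ADDITIVE at `v` with
  `ord_v Δ_min(V^{(d)}) = ord_v Δ_min(V) + 6` — so a globally minimal model `Cd • V^{(d)}` has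
  `ord_ℓ(Cd.u) = 0`: the `δ`-term of (L_ℓ)@p vanishes at such a place;
* `localTamagawaNumber_quadraticTwist_le_four_of_dvd_of_mult` — `c_v(V^{(d)}) ≤ 4` (Kodaira–Néron
  bound at a non-split place, tree `index_goodReductionSubgroup_le_four_holds`), whence
  `padicValNat_localTamagawaNumber_quadraticTwist_eq_zero_of_dvd_of_mult_of_five_le`:
  `v_p(c_v(V^{(d)})) = 0` for `p ≥ 5`.

HONEST LIMITS: TOOL theorems; the Kodaira type `I_n^*` and the sharper `c ∈ {2, 4}` (needed for the
`p = 3` rows) are NOT proved here — stage-B binder of the row, said loudly; `ℓ = 2` not treated;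
closes no class, discharges no fact by itself; nothing about any curve is asserted.
References: Silverman *AEC* VII.1 Remark 1.1, VII.5 Prop. 5.1; *ATAEC* Cor. IV.9.2 (d); Kramer,
Trans. AMS 264 (1981) §2.
-/

noncomputable section

open scoped Classical NumberField

open WeierstrassCurve NumberField IsDedekindDomain Rat.HeightOneSpectrum
  Literature.NumberTheory.EllipticCurves Literature.NumberTheory.EllipticCurves.Rank1Residual
  Literature.NumberTheory.GaloisRepresentations Field IsLocalRing
  Summit.BirchSwinnertonDyer.Rank1Residual.Additive

namespace Summit.BirchSwinnertonDyer.Rank1Residual.AdditivePotMult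

/-! ## The ramified twist of a multiplicative place -/

section RamifiedTwist

variable (V : WeierstrassCurve ℚ) [V.IsElliptic] [V.IsGloballyMinimal] (v : HeightOneSpectrum (𝓞 ℚ))

/-- **The ramified twist of a multiplicative place is additive with `ord Δ_min = n + 6`, and the
explicit twist equation is minimal there.** For `V/ℚ` globally minimal with multiplicative
reduction at the place `v` over an ODD prime `ℓ` with `ℓ ∥ d`: the equation
`V^{(d)} : y² = x³ + (d b₂/4)x² + (d² b₄/2)x + d³ b₆/4` is `v`-integral with
`ord_v c₄ = 2 < 4` — hence MINIMAL at `v` (Silverman VII.1 Remark 1.1) — and `ord_v Δ = n + 6`,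
`ord_v c₄ > 0`: ADDITIVE reduction of Kodaira type `I_n^*` (the type itself is not asserted
here). So in the odd part of Milne's identity the twist scaling `u_d` is an `ℓ`-unit at such a
place (`δ_{d,ℓ} = 0`, skeleton §1 (M)). [cite: SilvermanAEC2009, VII.1 Remark 1.1 and VII.5 Prop. 5.1(c)] -/
theorem hasAdditiveReductionAt_quadraticTwist_of_dvd_of_mult (hv2 : (primesEquiv v : ℕ) ≠ 2)
    {d : ℤ} (h1 : ((primesEquiv v : ℕ) : ℤ) ∣ d) (h2 : ¬ ((primesEquiv v : ℕ) : ℤ) ^ 2 ∣ d)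
    (hmult : V.HasMultiplicativeReductionAt v) :
    (V.quadraticTwist (d : ℚ)).IsMinimalAt v ∧ (V.quadraticTwist (d : ℚ)).HasAdditiveReductionAt v ∧
      (V.quadraticTwist (d : ℚ)).ordMinimalDiscriminant v = V.ordMinimalDiscriminant v + 6 := by
  have hpP : (primesEquiv v : ℕ).Prime := (primesEquiv v).2
  have hpZ : Prime ((primesEquiv v : ℕ) : ℤ) := Nat.prime_iff_prime_int.mp hpP
  have hd0 : d ≠ 0 := by rintro rfl; exact h2 (dvd_zero _)
  have hdq : (d : ℚ) ≠ 0 := by exact_mod_cast hd0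
  haveI := V.isElliptic_quadraticTwist hdq
  have hp2 : ¬ ((primesEquiv v : ℕ) : ℤ) ∣ 2 := fun h ↦
    hv2 ((Nat.prime_dvd_prime_iff_eq hpP Nat.prime_two).mp (Int.natCast_dvd_natCast.mp h))
  have hp4 : ¬ ((primesEquiv v : ℕ) : ℤ) ∣ 4 := fun h ↦
    (hpZ.dvd_or_dvd (show ((primesEquiv v : ℕ) : ℤ) ∣ 2 * 2 by norm_num; exact h)).elim hp2 hp2
  -- the integer model of `V`
  set M : WeierstrassCurve ℤ := integralModelInt V with hM
  have hVM : M.map (Int.castRingHom ℚ) = V := map_integralModelInt V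
  have hVb₂ : V.b₂ = (M.b₂ : ℚ) := by rw [← congrArg WeierstrassCurve.b₂ hVM, map_b₂, eq_intCast]
  have hVb₄ : V.b₄ = (M.b₄ : ℚ) := by rw [← congrArg WeierstrassCurve.b₄ hVM, map_b₄, eq_intCast]
  have hVb₆ : V.b₆ = (M.b₆ : ℚ) := by rw [← congrArg WeierstrassCurve.b₆ hVM, map_b₆, eq_intCast]
  have hv4 : v.valuation ℚ (4 : ℚ) = 1 := by
    have h := valuation_ringOfIntegers_intCast_eq_one v (n := 4) (by exact_mod_cast hp4)
    simpa using h
  have hv2' : v.valuation ℚ (2 : ℚ) = 1 := by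
    have h := valuation_ringOfIntegers_intCast_eq_one v (n := 2) (by exact_mod_cast hp2)
    simpa using h
  have hvD : v.valuation ℚ (d : ℚ) = WithZero.exp (-1 : ℤ) :=
    valuation_ringOfIntegers_intCast_eq_exp_neg_one v h1 h2
  -- `V` at `v`: minimal, `ord_v Δ = n`, `c₄` a unit
  have hminV : V.IsMinimalAt v := IsGloballyMinimal.isMinimal v
  have hΔV := valuation_Δ_eq_of_isMinimalAt_holds v V hminV
  have hc₄V : v.valuation ℚ V.c₄ = 1 := ((hasMultiplicativeReductionAt_iff_of_isMinimalAt hminV).mp hmult).2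
  have hvb₂ : v.valuation ℚ V.b₂ ≤ 1 := hVb₂ ▸ valuation_ringOfIntegers_intCast_le_one v _
  have hvb₄ : v.valuation ℚ V.b₄ ≤ 1 := hVb₄ ▸ valuation_ringOfIntegers_intCast_le_one v _
  have hvb₆ : v.valuation ℚ V.b₆ ≤ 1 := hVb₆ ▸ valuation_ringOfIntegers_intCast_le_one v _
  have he1 : WithZero.exp (-1 : ℤ) ≤ 1 := by
    rw [← WithZero.exp_zero]; exact WithZero.exp_le_exp.mpr (by norm_num)
  -- the twist equation is `v`-integral
  have hint : (V.quadraticTwist (d : ℚ)).IsIntegralAt v := by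
    refine (V.quadraticTwist (d : ℚ)).isIntegralAt_of_valuation_le_one v ?_ ?_ ?_ ?_ ?_
    · simp
    · simp only [quadraticTwist_a₂, map_div₀, map_mul, hv4, hvD, div_one]
      exact mul_le_one' he1 hvb₂
    · simp
    · simp only [quadraticTwist_a₄, map_div₀, map_mul, map_pow, hv2', hvD, div_one]
      exact mul_le_one' (pow_le_one' he1 2) hvb₄
    · simp only [quadraticTwist_a₆, map_div₀, map_mul, map_pow, hv4, hvD, div_one]
      exact mul_le_one' (pow_le_one' he1 3) hvb₆
  -- `ord_v c₄ = 2 < 4`: minimal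
  have hc₄ : v.valuation ℚ (V.quadraticTwist (d : ℚ)).c₄ = WithZero.exp (-2 : ℤ) := by
    rw [quadraticTwist_c₄, map_mul, map_pow, hvD, hc₄V, mul_one, ← WithZero.exp_nsmul]
    norm_num
  have hmin : (V.quadraticTwist (d : ℚ)).IsMinimalAt v :=
    isMinimalAt_of_lt_valuation_c₄ hint (by rw [hc₄]; exact WithZero.exp_lt_exp.mpr (by norm_num))
  -- `ord_v Δ = n + 6`
  have hΔ : v.valuation ℚ (V.quadraticTwist (d : ℚ)).Δ =
      WithZero.exp (-((V.ordMinimalDiscriminant v + 6 : ℕ) : ℤ)) := by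
    rw [quadraticTwist_Δ, map_mul, map_pow, hvD, hΔV, ← WithZero.exp_nsmul, ← WithZero.exp_add]
    congr 1
    push_cast
    ring
  refine ⟨hmin, (hasAdditiveReductionAt_iff_of_isMinimalAt hmin).mpr ⟨?_, ?_⟩, ?_⟩
  · rw [hΔ, ← WithZero.exp_zero]
    exact WithZero.exp_lt_exp.mpr (by omega)
  · rw [hc₄, ← WithZero.exp_zero]
    exact WithZero.exp_lt_exp.mpr (by norm_num)
  · have h := valuation_Δ_eq_of_isMinimalAt_holds v (V.quadraticTwist (d : ℚ)) hmin
    rw [hΔ, WithZero.exp_inj, neg_inj, Nat.cast_inj] at h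
    exact h.symm

/-- **`c_v(V^{(d)}) ≤ 4` at the ramified twist of a multiplicative place** (additive reduction;
Kodaira–Néron, tree `index_goodReductionSubgroup_le_four_holds` — the bound `4` at every place
that is not split multiplicative); hence `v_p(c_v(V^{(d)})) = 0` for every prime `p ≥ 5`. (For
`p = 3` the sharper `c ∈ {2, 4}` of type `I_n^*` is NOT proved here — stage-B binder of the row.)
[cite: SilvermanATAEC1994, Cor. IV.9.2(d) (PDF p. 340)] -/
theorem localTamagawaNumber_quadraticTwist_le_four_of_dvd_of_mult (hv2 : (primesEquiv v : ℕ) ≠ 2)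
    {d : ℤ} (h1 : ((primesEquiv v : ℕ) : ℤ) ∣ d) (h2 : ¬ ((primesEquiv v : ℕ) : ℤ) ^ 2 ∣ d)
    (hmult : V.HasMultiplicativeReductionAt v) :
    (((V.quadraticTwist (d : ℚ)).baseChange (v.adicCompletion ℚ)).localTamagawaNumber
        (v.adicCompletionIntegers ℚ)) ≤ 4 := by
  have hd0 : d ≠ 0 := by rintro rfl; exact h2 (dvd_zero _)
  have hdq : (d : ℚ) ≠ 0 := by exact_mod_cast hd0
  haveI := V.isElliptic_quadraticTwist hdq
  haveI : Finite (ResidueField (v.adicCompletionIntegers ℚ)) := Nat.finite_of_card_ne_zero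
    (by rw [WeierstrassCurve.natCard_residueField_adicCompletionIntegers v]; exact (primesEquiv v).2.ne_zero)
  haveI : PerfectField (ResidueField (v.adicCompletionIntegers ℚ)) := PerfectField.ofFinite
  obtain ⟨-, hadd, -⟩ := hasAdditiveReductionAt_quadraticTwist_of_dvd_of_mult V v hv2 h1 h2 hmult
  haveI : ((V.quadraticTwist (d : ℚ)).localMinimalModel v).IsElliptic :=
    (V.quadraticTwist (d : ℚ)).isElliptic_localMinimalModel v
  have hns : ¬ ((V.quadraticTwist (d : ℚ)).localMinimalModel v).HasSplitMultiplicativeReduction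
      (v.adicCompletionIntegers ℚ) := fun h =>
    (hadd.not_hasMultiplicativeReductionAt) h.toHasMultiplicativeReduction
  exact (((V.quadraticTwist (d : ℚ)).localMinimalModel v).index_goodReductionSubgroup_le_four_holds
    (v.adicCompletionIntegers ℚ) hns).2

/-- **`v_p(c_v(V^{(d)})) = 0` for `p ≥ 5` at the ramified twist of a multiplicative place**
(`c ≤ 4 < p`). The twist-side entry of (L_p)@p at the ramified prime `p ∣ d_K` when `V` is
multiplicative at `p` (row T-MIL-ODD §1 (M), `p ≥ 5`). [cite: SilvermanATAEC1994, Cor. IV.9.2(d) (PDF p. 340)] -/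
theorem padicValNat_localTamagawaNumber_quadraticTwist_eq_zero_of_dvd_of_mult_of_five_le
    (hv2 : (primesEquiv v : ℕ) ≠ 2) {d : ℤ} (h1 : ((primesEquiv v : ℕ) : ℤ) ∣ d)
    (h2 : ¬ ((primesEquiv v : ℕ) : ℤ) ^ 2 ∣ d) (hmult : V.HasMultiplicativeReductionAt v)
    (p : ℕ) [Fact p.Prime] (h5 : 5 ≤ p) :
    padicValNat p (((V.quadraticTwist (d : ℚ)).baseChange (v.adicCompletion ℚ)).localTamagawaNumber
        (v.adicCompletionIntegers ℚ)) = 0 := by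
  have hle := localTamagawaNumber_quadraticTwist_le_four_of_dvd_of_mult V v hv2 h1 h2 hmult
  refine padicValNat.eq_zero_of_not_dvd fun hdvd => ?_
  have hd0 : d ≠ 0 := by rintro rfl; exact h2 (dvd_zero _)
  have hdq : (d : ℚ) ≠ 0 := by exact_mod_cast hd0
  haveI := V.isElliptic_quadraticTwist hdq
  haveI : ((V.quadraticTwist (d : ℚ)).baseChange (v.adicCompletion ℚ)).IsElliptic := by
    rw [baseChange]; infer_instance
  have hpos : 0 < ((V.quadraticTwist (d : ℚ)).baseChange (v.adicCompletion ℚ)).localTamagawaNumber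
      (v.adicCompletionIntegers ℚ) :=
    Nat.pos_of_ne_zero (localTamagawaNumber_ne_zero_holds (v.adicCompletionIntegers ℚ) _)
  have := Nat.le_of_dvd hpos hdvd
  omega

end RamifiedTwist

end Summit.BirchSwinnertonDyer.Rank1Residual.AdditivePotMult

end
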